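import Summits.AnomalousDissipation.AnomalousDissipation.Theorems.MirrorVarietyTaylorGreenLoudGalerkinStatesStubTgForceRegular

/-!
# Negative knowledge for the crux `TaylorGreenLogLoudStates` (stmt-AnomalousDissipation-15060, route MirrorVariety), V-bis:
# K-cells have impermeable caps (zeroth-order mirror constraints)

Certified copy of part of §4a of the cdisprove work file `Cruxes/TaylorGreenLogLoudStates/Disproof.lean`
(refuter-cdisprove-stmt-AnomalousDissipation-15060-0). Supports stmt-AnomalousDissipation-15060; no definition, no positive
route-item statement. Zeroth-order companions of `Negative/MirrorClass.lean` (`partialDeriv_apply_eq_zero_of_isKSymm`,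
`vort_eq_zero_on_latticeLine`), stated against the line vocabulary `IsKSymm`, `reflMat`, `actVec` of
`Theorems/MirrorVarietyTaylorGreenLoudGalerkinStatesLine.lean`:

* `apply_eq_zero_of_isKSymm` — for a K-symmetric field the NORMAL velocity vanishes on each mirror plane `x_i ∈ {0, ½}`
  (`R_i x = x → U_i(x) = 0`): the faces of the K-cell are impermeable. In particular `U₂ = 0` on `x₂ ∈ {0, ½}`, so the picked
  line's "through-flow Burgers column on the `C₄` axis" (card `half-turn-parity-forcing`, heart `stub_heart`) has no through-flow:
  its axial velocity vanishes on both caps, `½` apart, and its axial strain `∂₂U₂` has zero mean along the axis between them —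
  half of any steady column in Fix K is axially compressed.
* `apply_eq_zero_on_latticeLine` — on a K-lattice line (two mirror planes) only the axial velocity component survives.
* `apply_eq_zero_at_latticePoint` — the 8 lattice points `{0, ½}³` are stagnation points of every K-symmetric field.
-/

noncomputable section

-- `Summit.<Summit>.<Problem>` is the tree's mandated summit-side namespace (CONVENTIONS §2); duplicate deliberate.
set_option linter.dupNamespace false

open Literature.Analysis.FunctionSpaces Literature.Analysis.FunctionSpaces.Torus
open Summit.AnomalousDissipation.AnomalousDissipation.Theorems.TaylorGreenLoudGalerkinStates (reflMat actVec IsKSymm)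
open Summit.AnomalousDissipation.AnomalousDissipation.Theorems.TaylorGreenLoudGalerkinStates.TgForceRegular
  (actVec_reflMat_apply)

namespace Summit.AnomalousDissipation.AnomalousDissipation.Theorems.TaylorGreenLogLoudStates.Negative

/-- **Impermeable faces.** For a K-symmetric field the normal velocity vanishes on each mirror plane:
`R_i x = x → U_i(x) = 0` (`x_i ∈ {0, ½}`). [folklore] -/
theorem apply_eq_zero_of_isKSymm {U : UnitAddTorus (Fin 3) → EuclideanSpace ℝ (Fin 3)} (hK : IsKSymm U) (i : Fin 3)
    {x : UnitAddTorus (Fin 3)} (hx : Torus.mulVecT (reflMat i) x = x) : U x i = 0 := by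
  have h1 : U (Torus.mulVecT (reflMat i) x) i = actVec (reflMat i) (U x) i := by rw [hK i x]
  rw [hx, actVec_reflMat_apply, if_pos rfl] at h1
  linarith

/-- **On a K-lattice line only the axial velocity survives**: at a point of two mirror planes both normal components vanish.
[folklore] -/
theorem apply_eq_zero_on_latticeLine {U : UnitAddTorus (Fin 3) → EuclideanSpace ℝ (Fin 3)} (hK : IsKSymm U)
    {i i' : Fin 3} {x : UnitAddTorus (Fin 3)} (hx : Torus.mulVecT (reflMat i) x = x)
    (hx' : Torus.mulVecT (reflMat i') x = x) : U x i = 0 ∧ U x i' = 0 :=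
  ⟨apply_eq_zero_of_isKSymm hK i hx, apply_eq_zero_of_isKSymm hK i' hx'⟩

/-- **The K-lattice points `{0,½}³` are stagnation points** of every K-symmetric field. [folklore] -/
theorem apply_eq_zero_at_latticePoint {U : UnitAddTorus (Fin 3) → EuclideanSpace ℝ (Fin 3)} (hK : IsKSymm U)
    {x : UnitAddTorus (Fin 3)} (hx : ∀ i, Torus.mulVecT (reflMat i) x = x) : U x = 0 := by
  ext i
  exact apply_eq_zero_of_isKSymm hK i (hx i)

end Summit.AnomalousDissipation.AnomalousDissipation.Theorems.TaylorGreenLogLoudStates.Negative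

end
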